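import Summits.KontsevichZagierPeriods.KontsevichZagierPeriods.Theorems.IsogenyCertificatesXMapKernelStubNonCMClass
import Summits.KontsevichZagierPeriods.KontsevichZagierPeriods.Theorems.IsogenyCertificatesXMapKernelStubRadicalIndependence
import Summits.KontsevichZagierPeriods.KontsevichZagierPeriods.Theorems.IsogenyCertificatesXMapKernelStubMultiplierRigidity
import Literature.NumberTheory.Transcendental.ManyCurvePeriodsIsotypicProofs

/-!
# `XMapKernel`, line `derived-datum-quasi-periods` — stub `stub_etaIndependence`: the non-CM class,
# auxiliary file (Masser's theorem for `u, v, η(u), η(iv)`)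

Support file for the crux `IsogenyCertificates.XMapKernel` (stmt-KontsevichZagierPeriods-10663),
line `derived-datum-quasi-periods`, stub `stub_etaIndependence`, hypothesis "class independence"
of its conditional form `stub_etaIndependence_of`, NON-CM case. For a real lattice `Λ₀` with
rational invariants and no complex multiplication let `u = Ω₀(Λ₀)`, `v = Ω₀(iΛ₀)` (so `u, iv ∈ Λ₀`
are `ℝ`-independent lattice vectors, `u = m₁ω₁ + n₁ω₂`, `iv = m₂ω₁ + n₂ω₂`) and let
`η(u) = m₁η₁ + n₁η₂`, `η(iv) = m₂η₁ + n₂η₂` be their quasi-periods. This file proves that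
`u, v, η(u), i·η(iv)` are linearly independent over `ℚ̄` (`indep_four`): in the basis
`ω₁, ω₂, η₁, η₂` the four numbers have an integer block matrix of non-zero determinant, and
`ω₁, ω₂, η₁, η₂` are `ℚ̄`-independent by Masser's Theorem II (`masser_ellipticPeriods_holds`).
No definitions, no named facts.

References: D. Masser, *Elliptic Functions and Transcendence*, LNM 437 (1975), Ch. II Thm. II.
-/

noncomputable section

namespace Summit.KontsevichZagierPeriods.IsogenyCertificates.XMapKernelStubs.EtaIndependence

open scoped BigOperators ComplexConjugate
open Complex Literature.NumberTheory.Transcendental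

/-- **Masser, four-period form.** For a lattice with algebraic invariants and no complex
multiplication, `ω₁, ω₂, η₁, η₂` are linearly independent over `ℚ̄` (sub-family of Masser's six
numbers `1, 2πi, ω₁, ω₂, η₁, η₂`, `masser_ellipticPeriods_holds`). [cite: Masser1975, Ch. II Thm. II] -/
theorem indep_omega_eta {L₀ : PeriodPair} (h₂ : IsAlgebraic ℚ L₀.g₂) (h₃ : IsAlgebraic ℚ L₀.g₃)
    (hCM : ¬ L₀.HasCM) {c₁ c₂ c₃ c₄ : ℂ} (hc₁ : IsAlgebraic ℚ c₁) (hc₂ : IsAlgebraic ℚ c₂)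
    (hc₃ : IsAlgebraic ℚ c₃) (hc₄ : IsAlgebraic ℚ c₄)
    (h : c₁ * L₀.ω₁ + c₂ * L₀.ω₂ + c₃ * L₀.η₁ + c₄ * L₀.η₂ = 0) :
    c₁ = 0 ∧ c₂ = 0 ∧ c₃ = 0 ∧ c₄ = 0 := by
  have hM := masser_ellipticPeriods_holds L₀ h₂ h₃ hCM
  have hβ : ∀ i, IsAlgebraic ℚ ((![0, 0, c₁, c₂, c₃, c₄] : Fin 6 → ℂ) i) := by
    intro i
    fin_cases i
    · exact isAlgebraic_zero
    · exact isAlgebraic_zero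
    · exact hc₁
    · exact hc₂
    · exact hc₃
    · exact hc₄
  have hs : ∑ i, (![0, 0, c₁, c₂, c₃, c₄] : Fin 6 → ℂ) i *
      ![1, 2 * Real.pi * I, L₀.ω₁, L₀.ω₂, L₀.η₁, L₀.η₂] i = 0 := by
    rw [Fin.sum_univ_six]
    show 0 * 1 + 0 * (2 * Real.pi * I) + c₁ * L₀.ω₁ + c₂ * L₀.ω₂ + c₃ * L₀.η₁ + c₄ * L₀.η₂ = 0
    rw [zero_mul, zero_mul, zero_add, zero_add]
    exact h
  have h6 := hM _ hβ hs
  exact ⟨h6 2, h6 3, h6 4, h6 5⟩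

/-- Integer relations among `ω₁, ω₂` are trivial. [folklore] -/
theorem int_rel_trivial (L₀ : PeriodPair) {s t : ℤ} (hst : (s : ℂ) * L₀.ω₁ + (t : ℂ) * L₀.ω₂ = 0) :
    s = 0 ∧ t = 0 := by
  have := LinearIndependent.pair_iff.mp L₀.indep (s : ℝ) (t : ℝ) (by simpa using hst)
  exact_mod_cast this

/-- **The determinant of `(u, iv)` in the basis `(ω₁, ω₂)` is non-zero**: for a real lattice with
`u = Ω₀(Λ₀) = m₁ω₁ + n₁ω₂` and `iv = m₂ω₁ + n₂ω₂`, `v = Ω₀(iΛ₀)`, one has `m₁n₂ − n₁m₂ ≠ 0`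
(`u` is real, `iv` purely imaginary, both non-zero). [folklore] -/
theorem det_ne_zero {L₀ : PeriodPair} (hreal : L₀.IsReal) {m₁ n₁ m₂ n₂ : ℤ}
    (e₁ : (m₁ : ℂ) * L₀.ω₁ + n₁ * L₀.ω₂ = (L₀.minRealPeriod : ℂ))
    (e₂ : (m₂ : ℂ) * L₀.ω₁ + n₂ * L₀.ω₂ = I * ((L₀.mulLeft I I_ne_zero).minRealPeriod : ℂ)) :
    (m₁ : ℂ) * n₂ - n₁ * m₂ ≠ 0 := by
  have hu : 0 < L₀.minRealPeriod := hreal.minRealPeriod_pos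
  have hv : 0 < (L₀.mulLeft I I_ne_zero).minRealPeriod := hreal.mulLeft_I.minRealPeriod_pos
  intro hD
  have f₁ : (n₂ : ℂ) * L₀.minRealPeriod - n₁ * (I * (L₀.mulLeft I I_ne_zero).minRealPeriod)
      = 0 := by
    have e : (n₂ : ℂ) * L₀.minRealPeriod - n₁ * (I * (L₀.mulLeft I I_ne_zero).minRealPeriod)
        = ((m₁ : ℂ) * n₂ - n₁ * m₂) * L₀.ω₁ := by
      rw [← e₁, ← e₂]; ring
    rw [e, hD, zero_mul]
  have f₂ : (m₂ : ℂ) * L₀.minRealPeriod - m₁ * (I * (L₀.mulLeft I I_ne_zero).minRealPeriod)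
      = 0 := by
    have e : (m₂ : ℂ) * L₀.minRealPeriod - m₁ * (I * (L₀.mulLeft I I_ne_zero).minRealPeriod)
        = -((m₁ : ℂ) * n₂ - n₁ * m₂) * L₀.ω₂ := by
      rw [← e₁, ← e₂]; ring
    rw [e, hD, neg_zero, zero_mul]
  have g₁ : (n₁ : ℝ) * (L₀.mulLeft I I_ne_zero).minRealPeriod = 0 := by
    have := congrArg Complex.im f₁
    simp only [sub_im, mul_im, intCast_re, intCast_im, ofReal_re, ofReal_im, I_re, I_im,
      mul_re, zero_im] at this
    linarith
  have g₂ : (m₁ : ℝ) * (L₀.mulLeft I I_ne_zero).minRealPeriod = 0 := by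
    have := congrArg Complex.im f₂
    simp only [sub_im, mul_im, intCast_re, intCast_im, ofReal_re, ofReal_im, I_re, I_im,
      mul_re, zero_im] at this
    linarith
  have hn₁ : n₁ = 0 := by exact_mod_cast (mul_eq_zero.1 g₁).resolve_right hv.ne'
  have hm₁ : m₁ = 0 := by exact_mod_cast (mul_eq_zero.1 g₂).resolve_right hv.ne'
  have e₁' := e₁
  rw [hn₁, hm₁, Int.cast_zero, zero_mul, zero_mul, zero_add] at e₁'
  exact hu.ne' (by exact_mod_cast e₁'.symm)

/-- **`u, v, η(u), i·η(iv)` are `ℚ̄`-independent.** For a real lattice `Λ₀` with rational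
invariants and no complex multiplication, `u = Ω₀(Λ₀) = m₁ω₁ + n₁ω₂`, `iv = m₂ω₁ + n₂ω₂`
(`v = Ω₀(iΛ₀)`), a relation `a·u + b·v + c·(m₁η₁ + n₁η₂) + d·i(m₂η₁ + n₂η₂) = 0` with algebraic
`a, b, c, d` is trivial: in the basis `ω₁, ω₂, η₁, η₂` it reads
`(am₁ − ibm₂)ω₁ + (an₁ − ibn₂)ω₂ + (cm₁ + idm₂)η₁ + (cn₁ + idn₂)η₂ = 0`, Masser's theorem
(`indep_omega_eta`) kills the four coefficients, and `m₁n₂ − n₁m₂ ≠ 0` (`det_ne_zero`).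
[cite: Masser1975, Ch. II Thm. II] -/
theorem indep_four {L₀ : PeriodPair} (h₂ : ∃ q : ℚ, (q : ℂ) = L₀.g₂)
    (h₃ : ∃ q : ℚ, (q : ℂ) = L₀.g₃) (hCM : ¬ L₀.HasCM) (hreal : L₀.IsReal) {m₁ n₁ m₂ n₂ : ℤ}
    (e₁ : (m₁ : ℂ) * L₀.ω₁ + n₁ * L₀.ω₂ = (L₀.minRealPeriod : ℂ))
    (e₂ : (m₂ : ℂ) * L₀.ω₁ + n₂ * L₀.ω₂ = I * ((L₀.mulLeft I I_ne_zero).minRealPeriod : ℂ))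
    {a b c d : ℂ} (ha : IsAlgebraic ℚ a) (hb : IsAlgebraic ℚ b) (hc : IsAlgebraic ℚ c)
    (hd : IsAlgebraic ℚ d)
    (hrel : a * L₀.minRealPeriod + b * (L₀.mulLeft I I_ne_zero).minRealPeriod +
      c * ((m₁ : ℂ) * L₀.η₁ + n₁ * L₀.η₂) + d * (I * ((m₂ : ℂ) * L₀.η₁ + n₂ * L₀.η₂)) = 0) :
    a = 0 ∧ b = 0 ∧ c = 0 ∧ d = 0 := by
  have ha₂ : IsAlgebraic ℚ L₀.g₂ := by
    obtain ⟨r, hr⟩ := h₂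
    rw [← hr]
    exact isAlgebraic_algebraMap r
  have ha₃ : IsAlgebraic ℚ L₀.g₃ := by
    obtain ⟨r, hr⟩ := h₃
    rw [← hr]
    exact isAlgebraic_algebraMap r
  have hI : IsAlgebraic ℚ I := by
    refine IsAlgebraic.of_pow (r := I) (n := 2) (by norm_num) ?_
    rw [I_sq]
    exact isAlgebraic_one.neg
  -- the relation in the basis `ω₁, ω₂, η₁, η₂`
  have hrel' : (a * m₁ + -I * b * m₂) * L₀.ω₁ + (a * n₁ + -I * b * n₂) * L₀.ω₂ +
      (c * m₁ + I * d * m₂) * L₀.η₁ + (c * n₁ + I * d * n₂) * L₀.η₂ = 0 := by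
    have e : (a * m₁ + -I * b * m₂) * L₀.ω₁ + (a * n₁ + -I * b * n₂) * L₀.ω₂ +
        (c * m₁ + I * d * m₂) * L₀.η₁ + (c * n₁ + I * d * n₂) * L₀.η₂
        = a * ((m₁ : ℂ) * L₀.ω₁ + n₁ * L₀.ω₂) - I * b * ((m₂ : ℂ) * L₀.ω₁ + n₂ * L₀.ω₂) +
          c * ((m₁ : ℂ) * L₀.η₁ + n₁ * L₀.η₂) + d * (I * ((m₂ : ℂ) * L₀.η₁ + n₂ * L₀.η₂)) := by
      ring
    rw [e, e₁, e₂]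
    linear_combination hrel - b * ((L₀.mulLeft I I_ne_zero).minRealPeriod : ℂ) * I_mul_I
  obtain ⟨hA, hB, hC, hD'⟩ := indep_omega_eta ha₂ ha₃ hCM
    ((ha.mul (isAlgebraic_int m₁)).add ((hI.neg.mul hb).mul (isAlgebraic_int m₂)))
    ((ha.mul (isAlgebraic_int n₁)).add ((hI.neg.mul hb).mul (isAlgebraic_int n₂)))
    ((hc.mul (isAlgebraic_int m₁)).add ((hI.mul hd).mul (isAlgebraic_int m₂)))
    ((hc.mul (isAlgebraic_int n₁)).add ((hI.mul hd).mul (isAlgebraic_int n₂))) hrel'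
  have hD := det_ne_zero hreal e₁ e₂
  have haD : a * ((m₁ : ℂ) * n₂ - n₁ * m₂) = 0 := by
    linear_combination (n₂ : ℂ) * hA - (m₂ : ℂ) * hB
  have hbD : -I * b * ((m₁ : ℂ) * n₂ - n₁ * m₂) = 0 := by
    linear_combination (m₁ : ℂ) * hB - (n₁ : ℂ) * hA
  have hcD : c * ((m₁ : ℂ) * n₂ - n₁ * m₂) = 0 := by
    linear_combination (n₂ : ℂ) * hC - (m₂ : ℂ) * hD'
  have hdD : I * d * ((m₁ : ℂ) * n₂ - n₁ * m₂) = 0 := by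
    linear_combination (m₁ : ℂ) * hD' - (n₁ : ℂ) * hC
  refine ⟨(mul_eq_zero.1 haD).resolve_right hD, ?_, (mul_eq_zero.1 hcD).resolve_right hD, ?_⟩
  · exact (mul_eq_zero.1 ((mul_eq_zero.1 hbD).resolve_right hD)).resolve_left
      (neg_ne_zero.2 I_ne_zero)
  · exact (mul_eq_zero.1 ((mul_eq_zero.1 hdD).resolve_right hD)).resolve_left I_ne_zero

/-- **Linear independence of radicals on a finset** (the landed stub R-b4
`stub_radicalIndependence`, Besicovitch/Mordell, re-indexed along `T ≃ Fin |T|`): positive reals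
`yⱼ` (`j ∈ T`) with rational squares and pairwise irrational ratios are `ℚ`-linearly independent.
[cite: Mordell1953, Pacific J. Math. 3, 625–630] -/
theorem radical_indep_finset : ∀ (k : ℕ) (T : Finset (Fin k)) (y : Fin k → ℝ) (c : Fin k → ℚ), (∀ j ∈ T, 0 < y j) → (∀ j ∈ T, ∃ a : ℚ, y j ^ 2 = (a : ℝ)) → (∀ j ∈ T, ∀ j' ∈ T, j ≠ j' → ¬ ∃ r : ℚ, y j = (r : ℝ) * y j') → ∑ j ∈ T, (c j : ℝ) * y j = 0 → ∀ j ∈ T, c j = 0 := by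
  intro k T y c hpos hsq hirr hsum
  classical
  intro j hj
  set eT := T.equivFin with heT
  have key := RadicalIndependence.stub_radicalIndependence 2 two_pos T.card
    (fun i => y (eT.symm i)) (fun i => c (eT.symm i))
    (fun i => hpos _ (eT.symm i).2) (fun i => hsq _ (eT.symm i).2)
    (fun i i' hii' => hirr _ (eT.symm i).2 _ (eT.symm i').2
      (fun h => hii' (eT.symm.injective (Subtype.ext h))))
    (by
      calc ∑ i, ((c (eT.symm i) : ℚ) : ℝ) * y (eT.symm i)
          = ∑ z : {z // z ∈ T}, ((c z : ℚ) : ℝ) * y z :=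
            eT.symm.sum_comp (fun z : {z // z ∈ T} => ((c z : ℚ) : ℝ) * y z)
        _ = ∑ z ∈ T, ((c z : ℚ) : ℝ) * y z := Finset.sum_coe_sort T (fun z => ((c z : ℚ) : ℝ) * y z)
        _ = 0 := hsum)
  have hcj := key (eT ⟨j, hj⟩)
  simp only [Equiv.symm_apply_apply] at hcj
  exact hcj

end Summit.KontsevichZagierPeriods.IsogenyCertificates.XMapKernelStubs.EtaIndependence

end
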